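import Summits.ABC.IUTFork.Conditional.AbcOfSHvolNoRepair
import HarnessLib

/-!
# Branch C, TARGET #1 — NO PRINT-SHAPED CONSTANT REPAIRS THE REGIME (`hreg`-shaped) BINDER EITHER: for EVERY `a, c ≥ 0` the binder
# «at every admissible `(λ, l)` and every genuine datum `T` that is NOT slot-constant, `T.HullEstimateOf δ_{a,c}(P,l)`» is FALSE AS TYPED
# (abc-iut cell, R2 S-chain team, seat abc-iut-s2-p2 gen 2, «U-LINE-NO-REPAIR» part 2; crux ThetaPartII = stmt-ABC-19678)

Record-only PROOF file (D-0012) of the abc-iut cell; TAKES NO SIDE on [IUTchIII] Cor. 3.12, on [IUTchIV] Thm. 1.10 or on any author.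
Sequel to `Conditional/AbcOfSHvolNoRepair.lean` (p456124: `not_hullVolume_printShape`, the (U) computable half with the print-SHAPED bound
`δ_{a,c} = ((l+1)/4)·((1 + a·d_mod/l)(log-diff + log-cond) + c·(2 log l + 52 + (20/3)·log(d*l)·π(d*l)))` refuted for every `a, c ≥ 0`). The
certificates of record carry the REGIME form of the binder (abc-iut-c312-8's `stub_hullRegime` shape: the estimate demanded only at data that are NOT
slot-constant; `a = 12`, `c = 1` is `hreg` of `abc_of_S_v4`/`v6K`/`v10M`, refuted by abc-iut-s2-p5's `not_hreg_v4`). The refuting family's points carry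
the mixed pair `(𝔭, 𝔭')` over `7` (`𝔭` a (P5)-bad pole, `𝔭'` not a pole), so by abc-iut-s2-p4's `PointDict.not_slotConstant_of_unequalHeightsPoint` NO
genuine datum there is slot-constant; abc-iut-s2-p1 gen 2's ONE-DATUM general-`δ` necessity `PointDict.pointMixedShare_le_sub_gain_of_hullEstimateOf`
(p446417) then meets `exists_quadWitness_shapeSlack_lt`:

* **`not_hullRegime_printShape`** — for every `a, c ≥ 0` the `hreg`-shaped binder with bound `δ_{a,c}` is FALSE AS TYPED at admissible data.

READING: on the typed (U) reading the regime restriction does not help any print-shaped constant; the repair of record is the Szpiro-bad cut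
(plan C-R28 (3)(α) / C-R32) or the (P) reading. Statements about the cell's typed objects, not about print; no side taken on any author;
typed ≠ proved. PROOF-ONLY file: no definitions, no named `Prop` facts. [cite: Mochizuki2012, IUTchIV Thm. 1.10 proof Step (v) p. 27–28]
[cite: Mochizuki2012, IUTchIV Cor. 2.2 (ii) proof (P1)–(P7) p. 44–46] [claim: Mochizuki2012, status: disputed] for every IUT quotation.
-/

noncomputable section

namespace Summit.ABC.IUTFork

open NumberField IsDedekindDomain Literature.IUT.LogVolume Literature.IUT.HodgeTheaters
open Literature.NumberTheory.DiophantineGeometry.GenEll Literature.NumberTheory.NumberFields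
open scoped Classical

namespace Conditional

open PointDict

/-- **NO PRINT-SHAPED CONSTANT REPAIRS THE LINE-OF-RECORD SHAPE (`hreg`-form).** For EVERY `a, c ≥ 0` the REGIME binder «at every admissible
`(λ, l)` and every genuine datum `T` that is NOT slot-constant, `T.HullEstimateOf δ_{a,c}(P,l)`» (abc-iut-c312-8's `stub_hullRegime` shape = the CONE binder
`hreg` of `abc_of_S_v4`/`v6K`/`v10M` at `a = 12`, `c = 1`: abc-iut-s2-p5's `not_hreg_v4`) is REFUTED: the family's points carry the mixed pair
`(𝔭, 𝔭')` over `7` (abc-iut-s2-p4's `PointDict.not_slotConstant_of_unequalHeightsPoint`), so the datum of abc-iut-L5-t7's `ThetaPartII.stub_thetaData` is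
not slot-constant, and abc-iut-s2-p1 gen 2's ONE-DATUM general-`δ` necessity `PointDict.pointMixedShare_le_sub_gain_of_hullEstimateOf` (p446417) meets
`exists_quadWitness_shapeSlack_lt` (p456124). A statement about the cell's typed objects; no side taken; typed ≠ proved.
[cite: Mochizuki2012, IUTchIV Thm. 1.10 Steps (v)–(viii) p. 27–31] [cite: Mochizuki2012, IUTchIV Cor. 2.2 (ii) proof p. 44–46]
[claim: Mochizuki2012, status: disputed] -/
theorem not_hullRegime_printShape (a c : ℝ) (ha : 0 ≤ a) (hc : 0 ≤ c) :
    ¬ (∀ P : NFPoint, P ∈ UP → ∀ l : ℕ, l.Prime → 5 ≤ l →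
      Cor22.AdmitsCore P → Cor22.CondP2 P l → Cor22.CondP5 P l → Cor22.CondP6 P l →
      ∀ T : Cor22.ThetaVolumeDatumAt P l,
        (letI := T.instFieldF; letI := T.instNumberFieldF; letI := T.instAlgebraF; letI := T.instFieldK
         letI := T.instNumberFieldK; letI := T.instAlgebraK; letI := T.instFieldFbar; letI := T.instAlgebraFbar
         letI := T.instAlgebraKFbar; letI := T.instIsElliptic
         ¬ (∀ p ∈ T.I.supportPrimes, ∀ v w : placesOver (fieldOfModuli T.E) p,
            (Summit.ABC.IUTFork.DHData.ofInput T.I).logQloc p v = (Summit.ABC.IUTFork.DHData.ofInput T.I).logQloc p w)) →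
        T.HullEstimateOf
          (((l : ℝ) + 1) / 4 *
            ((1 + a * (Cor22.dmod P : ℝ) / l) * (P.logDiff + Cor22.logCondAvoid P {2, l})
              + c * (2 * Real.log l + 52
                + 20 / 3 * Real.log (((2 ^ 12 * 3 ^ 3 * 5 * Cor22.dmod P : ℕ) : ℝ) * (l : ℝ))
                  * (Nat.primeCounting (2 ^ 12 * 3 ^ 3 * 5 * Cor22.dmod P * l) : ℝ))))) := by
  intro hreg
  haveI h7p : Fact (Nat.Prime 7) := ⟨by norm_num⟩
  obtain ⟨𝔭, 𝔭', ha𝔭, habar, ha', -, h7, h7'⟩ := QuadWitness.exists_places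
  obtain ⟨k, hk6, l, hlp, hl7, hlp', hP2, hP5, hP6, h4d, -, hω, hlt⟩ :=
    exists_quadWitness_shapeSlack_lt a c ha hc ha𝔭 habar ha' h7 h7' 0
  have hk1 : 1 ≤ k := by omega
  have hP : QuadWitness.P k ∈ UP := QuadWitness.P_mem_UP ha𝔭 habar ha' h7 h7' hk6
  have hcore : Cor22.AdmitsCore (QuadWitness.P k) := QuadWitness.admitsCore_P ha𝔭 h7 hk1
  have h5 : 5 ≤ l := le_trans (by norm_num) hl7
  have hl0 : 0 < l := by omega
  have h𝔭 : 𝔭 ∈ placesOver QuadWitness.F 7 := Cor22.mem_placesOver_of_natCast_mem 7 𝔭 h7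
  have h𝔭' : 𝔭' ∈ placesOver QuadWitness.F 7 := Cor22.mem_placesOver_of_natCast_mem 7 𝔭' h7'
  -- `𝔭` is a (P5)-bad place at `(P_k, l)`, `𝔭'` is not even a pole (as in abc-iut-s2-p5's `not_hreg_v4`)
  have hjv : ord QuadWitness.F 𝔭 (Cor22.jInv (QuadWitness.lam k)) ≤ -(2 * k : ℤ) := QuadWitness.ord_jInv_lam_le ha𝔭 h7 hk1
  have hVb : 𝔭 ∈ Cor22.badPlacesAvoid (QuadWitness.P k) {2, l} := by
    rw [Cor22.badPlacesAvoid, Finset.mem_filter, Cor22.mem_badPlaces_iff_ord_neg]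
    refine ⟨by change ord QuadWitness.F 𝔭 (Cor22.jInv (QuadWitness.lam k)) < 0; omega, fun p hp => ?_⟩
    simp only [Finset.mem_insert, Finset.mem_singleton] at hp
    rcases hp with rfl | rfl
    · exact SplitDepth.natCast_not_mem_of_prime_ne ⟨𝔭, h𝔭⟩ Nat.prime_two (by norm_num)
    · exact SplitDepth.natCast_not_mem_of_prime_ne ⟨𝔭, h𝔭⟩ hlp hlp'
  have hWnot : 𝔭' ∉ Cor22.badPlacesAvoid (QuadWitness.P k) {2, l} := by
    intro hmem
    have hb := (Cor22.mem_badPlaces_iff_ord_neg (QuadWitness.P k) 𝔭').mp (Cor22.badPlacesAvoid_subset _ _ hmem)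
    have h0 : ord QuadWitness.F 𝔭' (Cor22.jInv (QuadWitness.lam k)) = 0 := (QuadWitness.ord_at_good h7' habar ha' k).2
    change ord QuadWitness.F 𝔭' (Cor22.jInv (QuadWitness.lam k)) < 0 at hb
    omega
  obtain ⟨T⟩ := Summit.ABC.ABC.Theorems.ThetaPartII.stub_thetaData (QuadWitness.P k) hP l hlp h5 hcore hP2 hP5 hP6
  have hns := not_slotConstant_of_unequalHeightsPoint T h𝔭 h𝔭' hVb (fun hW => absurd hW hWnot)
  have hT := hreg (QuadWitness.P k) hP l hlp h5 hcore hP2 hP5 hP6 T hns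
  have h := pointMixedShare_le_sub_gain_of_hullEstimateOf T hT hl0 h4d
    {7} (fun p hp => by rw [Finset.mem_singleton] at hp; subst hp; norm_num) hω
  exact absurd h (not_le.mpr hlt)

end Conditional

end Summit.ABC.IUTFork

end
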